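import Summits.ResolutionOfSingularities.ResolutionOfSingularities.Theorems.HilbertSamuelEliminationCampaignW42ChartFibre
import Literature.AlgebraicGeometry.Resolution.Ridge
import Literature.NumberTheory.DiophantineGeometry.CafureMateraLemma22MultiplicityProofs
import Mathlib.RingTheory.MvPolynomial.Ideal
import Mathlib.RingTheory.Ideal.IsPrimary
import Mathlib.RingTheory.Ideal.Maps
import Mathlib.RingTheory.LocalRing.ResidueField.Ideal
import HarnessLib

/-!
# [OURS · L1 W4.2] Ridge confinement of near points — the HYPERSURFACE case, every characteristic
# (campaign s42 of cell res-hironaka, LADDER-RESOLUTION rung L; hypersurface instance of the informal crux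
# `RidgeConfinement`, stmt-ResolutionOfSingularities-17845, route HilbertSamuelElimination; `--supports`, NOT a closing file)

HONEST FRAMING. Everything below is OURS (campaign mathematics of slot W4.2 «replace the directrix by Giraud's RIDGE in
CJS Thm. 3.14», prover res-L1-s42-pv-1) and elementary commutative algebra over the TREE's own objects. NOTHING here is a
statement of H. Hironaka's manuscript [Hironaka2017]; nothing here asserts that any statement of that manuscript holds or
fails. The identification of the objects below with the scheme-level `Scheme.ridge` / `Scheme.hsFun` of `RidgeLocal.lean` /
`HilbertSamuelStrata.lean` is NOT made here (the projectivised quotient `ℙ(F_x(X)/T_x(D))` is an open definition request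
of the slot); this is the chart-level algebra such a statement specialises to for hypersurfaces. AI review is weaker than
expert review.

## Setting and what is proved (sorry-free)

`K` a field of ANY characteristic, `f ∈ K[X_σ]`, `D = V(X_i : i ∈ A)` a coordinate centre, `j ∈ A`,
`f_𝔙 = coordProperTransform K A j f` the proper transform on the `j`-chart of the blow-up along `D` (tree: the chart of the
blown-up hypersurface is `Spec K[X]/(f_𝔙)`), `l = centreOrder A f = ord_D f` (`= ord_0 f` in the equimultiple situation,
`centreOrder_eq_of_le_of_ne_zero`), `F = homogeneousComponent l f` (then the initial form `in_0 f ∈ K[X_i : i ∈ A]`,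
`C_0 = V(F)` the tangent cone). Giraud's ridge (faîte) of the cone `V(F)` is the tree's functor
`Literature.AlgebraicGeometry.Resolution.ridge κ (Ideal.span {F})` (`Ridge.lean`: the `κ`-points whose translation preserves
the cone ideal). A point `x'` of the chart over the origin of `D` with values in a field `κ` is a `K`-algebra map
`π : K[X_σ] → κ` with `π X_j = 0` (exceptional divisor) and `π X_i = 0`, `i ∉ A` (over the origin); its direction in
`π⁻¹(0) = ℙ(T_0 𝔸^σ/T_0 D)` is `v`, `v_j = 1`, `v_i = π X_i` (`i ∈ A ∖ j`). NEAR: the multiplicity did not drop,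
`ord_{x'} f_𝔙 ≥ l`, typed `∃ s, π s ≠ 0 ∧ s · f_𝔙 ∈ (ker π)^l` (`⇔ f_𝔙 ∈ (ker π)^l K[X]_{ker π}`; for a hypersurface in a
regular ambient space the Hilbert–Samuel function is determined by the multiplicity — the CJS near condition read in the chart).

* `fibreRestrict_mul_mem_pow` — transport of the near condition to the fibre `π⁻¹(0) ∩ {X_j ≠ 0}`.
* **`exists_form_eq_aeval_of_near`** — STRUCTURE THEOREM: at a near point, over `κ`,
  `F ⊗_K κ = G(X_i − π(X_i)·X_j : i ∈ A ∖ j)` for a FORM `G` of degree `l` in the variables `X_i`, `i ∈ A ∖ j`: the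
  initial form is a form in `|A| − 1` linear forms vanishing on the line `x'` and on `T_0 D` — `x'` lies in the
  projectivised DIRECTRIX of the base-changed cone `C_0 ⊗_K κ` modulo `T_0 D` (over `κ(x)` itself the directrix can be
  smaller: Hironaka's quadric, barrier `Literature.Barriers.ResolutionOfSingularities.DirectrixSmallCharacteristic`, whose
  near point has an inseparable residue extension of degree `4` while `Dir_x = 0`).
* **`mem_ridge_of_near`**, `shift_map_eq_of_near`, **`residue_mem_ridge_of_near`** — hence translation by `v` fixes
  `F ⊗ κ` and **`v ∈ ridge κ (Ideal.span {F})`: the near point lies in `ℙ(F(C_0)/T_0 D)(κ)`, Giraud's ridge, with NO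
  hypothesis on `char K`, on `dim`, or on `κ(x')/κ(x)`** (stated for `κ`-valued points and for every prime `𝔴` of the
  chart ring with its residue field `κ(𝔴)`); `mem_ridge_of_forall_eq_zero` — `T_0(D)(κ) ⊆ F(C_0)(κ)`.

Proof (ours, elementary): by `fibreRestrict_coordProperTransform` the near condition gives `F(X_j:=1) ∈ 𝔪^l` up to a unit,
`𝔪 = ker π`; after base change to `κ` the point is rational with maximal ideal `𝔪_b = (X_i − b_i)`, `b_i = π X_i`, whose
powers are primary, so `F(X_j:=1) ⊗ κ ∈ 𝔪_b^l`; its Taylor translate `G` to the origin lies in `(X)^l` (tree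
`CafureMateraLemma22.shift_mem_pow_idealOfVars`) and has total degree `≤ l`, hence is an `l`-FORM; `F ⊗ κ` and
`G(X_i − b_i X_j)` are `l`-forms with the same dehomogenisation, hence equal. For the special hypersurfaces `Z^p + F(U)` at
`K`-rational closed points this is the tree's `PointBlowupNearRidge.lean` (cell pub-rosobs); the present file removes the
special shape, the rationality and the closedness of `x'`.

References (orientation only, nothing is cited as a premise): J. Giraud, Ann. Sci. ÉNS (4) 8 (1975) §1.5, Cor. 2.4;
V. Cossart, U. Jannsen, S. Saito, LNM 2270 (2020), Def. 3.13, Thm. 3.14, Rem. 18.29, Ex. 18.30; V. Cossart, O. Piltant,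
J. Algebra 320 (2008), proof of Prop. 4.2, (10)–(11).
-/

noncomputable section

-- single-conjunct summit: the doubled namespace component `ResolutionOfSingularities` is mandated
set_option linter.dupNamespace false

open MvPolynomial
open Literature.AlgebraicGeometry.Resolution Literature.RingTheory.MvPolynomial

namespace Summit.ResolutionOfSingularities.ResolutionOfSingularities.Theorems

namespace CampaignW42

universe u v w

/-! ## Transport of the near condition to the fibre -/

section Near

variable (R : Type u) [CommRing R] {σ : Type v} [DecidableEq σ] (A : Set σ) (j : σ)

/-- Modulo an ideal containing `X_j` and the `X_i`, `i ∉ A`, every polynomial agrees with its fibre restriction.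
[folklore] -/
theorem sub_fibreRestrict_mem {Q : Ideal (MvPolynomial σ R)} (hQj : (X j : MvPolynomial σ R) ∈ Q)
    (hQ : ∀ i ∉ A, (X i : MvPolynomial σ R) ∈ Q) (p : MvPolynomial σ R) :
    p - fibreRestrict R A j p ∈ Q := by
  classical
  have key : (Ideal.Quotient.mkₐ R Q).comp (fibreRestrict R A j) = Ideal.Quotient.mkₐ R Q := by
    refine MvPolynomial.algHom_ext fun i => ?_
    rw [AlgHom.comp_apply]
    by_cases hi : i ∈ A ∧ i ≠ j
    · rw [fibreRestrict_X_of_mem_of_ne R A j hi.1 hi.2]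
    · rw [fibreRestrict_X, if_neg hi, map_zero, Ideal.Quotient.mkₐ_eq_mk, eq_comm,
        Ideal.Quotient.eq_zero_iff_mem]
      by_cases hiA : i ∈ A
      · have hij : i = j := by
          by_contra hij
          exact hi ⟨hiA, hij⟩
        rw [hij]
        exact hQj
      · exact hQ i hiA
  have h := AlgHom.congr_fun key p
  rw [AlgHom.comp_apply, Ideal.Quotient.mkₐ_eq_mk] at h
  rw [← Ideal.Quotient.mk_eq_mk_iff_sub_mem]
  exact h.symm

/-- Such an ideal is stable under the fibre restriction. [folklore] -/
theorem map_fibreRestrict_le {Q : Ideal (MvPolynomial σ R)} (hQj : (X j : MvPolynomial σ R) ∈ Q)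
    (hQ : ∀ i ∉ A, (X i : MvPolynomial σ R) ∈ Q) : Q.map (fibreRestrict R A j) ≤ Q := by
  rw [Ideal.map_le_iff_le_comap]
  intro q hq
  rw [Ideal.mem_comap]
  have h := Q.sub_mem hq (sub_fibreRestrict_mem R A j hQj hQ q)
  rwa [sub_sub_cancel] at h

/-- **Transport of the near condition**: if `s · g ∈ Q^n` with `s ∉ Q`, then the same holds for the fibre
restrictions (`ρ(s) ≡ s`, `ρ(Q) ⊆ Q`). [folklore] -/
theorem fibreRestrict_mul_mem_pow {Q : Ideal (MvPolynomial σ R)} (hQj : (X j : MvPolynomial σ R) ∈ Q)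
    (hQ : ∀ i ∉ A, (X i : MvPolynomial σ R) ∈ Q) {s g : MvPolynomial σ R} (hs : s ∉ Q) {n : ℕ}
    (h : s * g ∈ Q ^ n) :
    fibreRestrict R A j s ∉ Q ∧ fibreRestrict R A j s * fibreRestrict R A j g ∈ Q ^ n := by
  refine ⟨fun h' => hs ?_, ?_⟩
  · have := Q.add_mem (sub_fibreRestrict_mem R A j hQj hQ s) h'
    rwa [sub_add_cancel] at this
  · rw [← map_mul]
    have hm := Ideal.mem_map_of_mem (fibreRestrict R A j) h
    rw [Ideal.map_pow] at hm
    exact Ideal.pow_right_mono (map_fibreRestrict_le R A j hQj hQ) n hm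

end Near

/-! ## Base change to the residue field of the point -/

section Point

variable {K : Type u} [Field K] {σ : Type v} {κ : Type w} [Field κ] [Algebra K κ]

/-- A `K`-algebra map `π : K[X] → κ` is evaluation at `b = (π(X_i))_i` after base change. [folklore] -/
theorem eval_map_algebraMap (π : MvPolynomial σ K →ₐ[K] κ) (p : MvPolynomial σ K) :
    eval (fun i => π (X i)) (map (algebraMap K κ) p) = π p := by
  rw [eval_map, ← aeval_def]
  exact (AlgHom.congr_fun (aeval_unique π) p).symm

/-- The kernel of `π` extends into the (rational, maximal) ideal of the point `b` of `𝔸^σ_κ`. [folklore] -/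
theorem map_ker_le_ker_eval (π : MvPolynomial σ K →ₐ[K] κ) :
    (RingHom.ker π).map (map (algebraMap K κ)) ≤ RingHom.ker (eval fun i => π (X i)) := by
  rw [Ideal.map_le_iff_le_comap]
  intro q hq
  rw [Ideal.mem_comap, RingHom.mem_ker, eval_map_algebraMap]
  exact hq

/-- Powers of a maximal ideal are primary: `s · g ∈ 𝔪^n`, `s ∉ 𝔪` ⟹ `g ∈ 𝔪^n`. [folklore] -/
theorem mem_pow_of_mul_mem_pow {S : Type w} [CommRing S] {m : Ideal S} (hm : m.IsMaximal) {s g : S}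
    (hs : s ∉ m) {n : ℕ} (h : s * g ∈ m ^ n) : g ∈ m ^ n := by
  rcases Nat.eq_zero_or_pos n with hn | hn
  · rw [hn, pow_zero, Ideal.one_eq_top]
    exact Submodule.mem_top
  · have hrad : (m ^ n).radical = m := by
      rw [Ideal.radical_pow m hn.ne', hm.isPrime.radical]
    have hprim : (m ^ n).IsPrimary := Ideal.isPrimary_of_isMaximal_radical (hrad.symm ▸ hm)
    have h' : g * s ∈ m ^ n := by rwa [mul_comm] at h
    rcases (Ideal.isPrimary_iff.mp hprim).2 h' with hg | hs'
    · exact hg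
    · rw [hrad] at hs'
      exact absurd hs' hs

/-- A polynomial in the `n`-th power of the ideal of the origin and of total degree `≤ n` is a FORM of degree `n`.
[folklore] -/
theorem isHomogeneous_of_mem_pow_idealOfVars {S : Type w} [CommRing S] {G : MvPolynomial σ S} {n : ℕ}
    (h1 : G ∈ idealOfVars σ S ^ n) (h2 : G.totalDegree ≤ n) : G.IsHomogeneous n := by
  rw [G.as_sum]
  refine IsHomogeneous.sum _ _ _ fun d hd => isHomogeneous_monomial _ (le_antisymm ?_ ?_)
  · exact (le_totalDegree hd).trans h2
  · exact (mem_pow_idealOfVars_iff n G).mp h1 d hd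

end Point

/-! ## The structure theorem and ridge confinement -/

section Main

variable {K : Type u} [Field K] {σ : Type v} [DecidableEq σ] {κ : Type w} [Field κ] [Algebra K κ]

/-- **STRUCTURE THEOREM (forms).** Let `F ∈ K[X_σ]` be a form of degree `n` whose dehomogenisation `F(X_j := 1)`
involves only the variables `X_i`, `i ∈ A ∖ j`, and let `π : K[X_σ] → κ` be a point of the `j`-chart over the origin
of `V(X_i : i ∈ A)` (`π X_j = 0`, `π X_i = 0` off `A`) at which `F(X_j := 1)` has order `≥ n`
(`∃ s ∉ ker π, s · F(X_j:=1) ∈ (ker π)^n`). Then over `κ` the form `F` is a form `G` of degree `n` in the linear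
forms `X_i − π(X_i) X_j`, `i ∈ A ∖ j`: `F ⊗ κ = G(X_i − π(X_i)·X_j)`, `G` involving only `X_i`, `i ∈ A ∖ j`.
[folklore] -/
theorem exists_form_eq_aeval_of_dehomog_mem_pow {A : Set σ} {j : σ} {F : MvPolynomial σ K} {n : ℕ}
    (hF : F.IsHomogeneous n) (hFA : fibreRestrict K A j (dehomog K j F) = dehomog K j F)
    (π : MvPolynomial σ K →ₐ[K] κ) (hπj : π (X j) = 0) (hπA : ∀ i ∉ A, π (X i) = 0)
    (hnear : ∃ s, π s ≠ 0 ∧ s * dehomog K j F ∈ RingHom.ker π ^ n) :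
    ∃ G : MvPolynomial σ κ, G.IsHomogeneous n ∧ fibreRestrict κ A j G = G ∧
      map (algebraMap K κ) F = aeval (fun i => X i - C (π (X i)) * X j) G := by
  classical
  obtain ⟨s, hs, hsg⟩ := hnear
  set b : σ → κ := fun i => π (X i) with hb
  set g := dehomog K j F with hg
  -- base change: `g ⊗ κ ∈ 𝔪_b^n`
  have hmax : (RingHom.ker (eval b)).IsMaximal :=
    RingHom.ker_isMaximal_of_surjective (eval b) fun c => ⟨C c, eval_C c⟩
  have hprod : map (algebraMap K κ) s * map (algebraMap K κ) g ∈ RingHom.ker (eval b) ^ n := by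
    rw [← map_mul]
    have hm := Ideal.mem_map_of_mem (map (algebraMap K κ)) hsg
    rw [Ideal.map_pow] at hm
    exact Ideal.pow_right_mono (map_ker_le_ker_eval π) n hm
  have hsb : map (algebraMap K κ) s ∉ RingHom.ker (eval b) := by
    rw [RingHom.mem_ker, eval_map_algebraMap]
    exact hs
  have hgb : map (algebraMap K κ) g ∈ RingHom.ker (eval b) ^ n := mem_pow_of_mul_mem_pow hmax hsb hprod
  -- Taylor translate to the origin: an `n`-form `G`
  set G := shift b (map (algebraMap K κ) g) with hG
  have hG1 : G ∈ idealOfVars σ κ ^ n :=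
    Literature.NumberTheory.DiophantineGeometry.CafureMateraLemma22.shift_mem_pow_idealOfVars b n hgb
  have hG2 : G.totalDegree ≤ n :=
    calc G.totalDegree ≤ (map (algebraMap K κ) g).totalDegree := totalDegree_shift_le b _
      _ ≤ g.totalDegree := Finset.sup_mono (support_map_subset _ _)
      _ ≤ F.totalDegree := totalDegree_dehomog_le K j F
      _ ≤ n := hF.totalDegree_le
  have hGhom : G.IsHomogeneous n := isHomogeneous_of_mem_pow_idealOfVars hG1 hG2
  have hbj : b j = 0 := hπj
  have hbA : ∀ i ∉ A, b i = 0 := hπA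
  have hGfix : fibreRestrict κ A j G = G := by
    rw [hG, fibreRestrict_shift κ A j b hbj hbA, ← map_fibreRestrict, hFA]
  refine ⟨G, hGhom, hGfix, ?_⟩
  -- the two `n`-forms `F ⊗ κ` and `G(X_i − b_i X_j)` have the same dehomogenisation
  have hH : (aeval (fun i => X i - C (π (X i)) * X j) G).IsHomogeneous n := by
    have h := hGhom.aeval (fun i => X i - C (π (X i)) * X j)
      (fun i => (isHomogeneous_X κ i).sub ((isHomogeneous_X κ j).C_mul (π (X i))))
    rwa [one_mul] at h
  refine eq_of_dehomog_eq_of_isHomogeneous κ j (hF.map _) hH ?_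
  rw [← map_dehomog, ← hg, ← AlgHom.comp_apply, comp_aeval,
    aeval_congr_of_fibreRestrict_eq κ A j hGfix (ψ := fun i => X i + C ((-b) i)) ?_]
  · change map (algebraMap K κ) g = shift (-b) G
    rw [hG, shift_shift, neg_add_cancel, shift_zero]
  · intro i _ hij
    simp only [map_sub, map_mul, dehomog_X_of_ne κ j hij, dehomog_C, dehomog_X_self, mul_one, Pi.neg_apply,
      C_neg, hb]
    ring

/-- **Translation invariance**: under the hypotheses of the structure theorem, `F ⊗ κ` is invariant under the
translation by every vector `v` with `v_j = 1` and `v_i = π(X_i)` for `i ∈ A ∖ j` (arbitrary along `T_0 D`).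
[folklore] -/
theorem shift_map_eq_of_dehomog_mem_pow {A : Set σ} {j : σ} {F : MvPolynomial σ K} {n : ℕ}
    (hF : F.IsHomogeneous n) (hFA : fibreRestrict K A j (dehomog K j F) = dehomog K j F)
    (π : MvPolynomial σ K →ₐ[K] κ) (hπj : π (X j) = 0) (hπA : ∀ i ∉ A, π (X i) = 0)
    (hnear : ∃ s, π s ≠ 0 ∧ s * dehomog K j F ∈ RingHom.ker π ^ n)
    (v : σ → κ) (hvj : v j = 1) (hv : ∀ i ∈ A, i ≠ j → v i = π (X i)) :
    shift v (map (algebraMap K κ) F) = map (algebraMap K κ) F := by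
  obtain ⟨G, -, hGfix, hFG⟩ := exists_form_eq_aeval_of_dehomog_mem_pow hF hFA π hπj hπA hnear
  rw [hFG, ← AlgHom.comp_apply, comp_aeval]
  refine aeval_congr_of_fibreRestrict_eq κ A j hGfix fun i hiA hij => ?_
  simp only [map_sub, map_mul, shift_X, algHom_C, MvPolynomial.algebraMap_eq, hv i hiA hij, hvj, map_one]
  ring

variable {m : ℕ}

/-- Translation invariance of the generator gives membership in Giraud's ridge of the principal cone.
[folklore] -/
theorem mem_ridge_span_singleton_of_shift_map_eq {F : MvPolynomial (Fin m) K} {v : Fin m → κ}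
    (h : shift v (map (algebraMap K κ) F) = map (algebraMap K κ) F) :
    v ∈ ridge κ (Ideal.span {F}) := by
  rw [mem_ridge_iff_forall_mem]
  intro f hf
  obtain ⟨c, rfl⟩ := Ideal.mem_span_singleton'.mp hf
  rw [map_mul, map_mul, h]
  exact Ideal.mul_mem_left _ _ (map_mem_coneIdeal κ (Ideal.subset_span rfl))

/-- **RIDGE CONFINEMENT OF NEAR POINTS — HYPERSURFACES, EVERY CHARACTERISTIC** [OURS · L1 W4.2; the hypersurface
instance of the informal crux `RidgeConfinement`, stmt-ResolutionOfSingularities-17845; NOT a statement of the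
manuscript]. Let `f ∈ K[X_1, …, X_m]`, `D = V(X_i : i ∈ A)` a coordinate centre, `j ∈ A`,
`f_𝔙 = coordProperTransform K A j f` the proper transform on the `j`-chart of the blow-up along `D` (the chart of
the blown-up hypersurface is `Spec K[X]/(f_𝔙)`, tree `quotientCoordProperTransformEquiv`), `l = centreOrder A f`
(`= ord_0 f` when `D` is permissible for `V(f)` at `0`, `centreOrder_eq_of_le_of_ne_zero`) and
`F = homogeneousComponent l f` (then the initial form `in_0 f`). Let `x'` be a point of the chart over the origin
of `D` with values in a field `κ`: `π : K[X] →ₐ[K] κ`, `π X_j = 0`, `π X_i = 0` (`i ∉ A`). If `x'` is NEAR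
(`ord_{x'} f_𝔙 ≥ l`: `∃ s ∉ ker π, s · f_𝔙 ∈ (ker π)^l`), then its direction `v` (`v_j = 1`, `v_i = π X_i` on
`A ∖ j`, arbitrary along `T_0 D`) is a `κ`-point of Giraud's ridge of the tangent cone `V(F)`:
`v ∈ ridge κ (Ideal.span {F})`, i.e. **`x' ∈ ℙ(F_0(X)/T_0(D))`** — with no hypothesis on `char K` or on
`κ(x')/κ(x)`. [folklore] -/
theorem mem_ridge_of_near (A : Set (Fin m)) {j : Fin m} (hj : j ∈ A) (f : MvPolynomial (Fin m) K)
    (π : MvPolynomial (Fin m) K →ₐ[K] κ) (hπj : π (X j) = 0) (hπA : ∀ i ∉ A, π (X i) = 0)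
    (hnear : ∃ s, π s ≠ 0 ∧ s * coordProperTransform K A j f ∈ RingHom.ker π ^ centreOrder A f)
    (v : Fin m → κ) (hvj : v j = 1) (hv : ∀ i ∈ A, i ≠ j → v i = π (X i)) :
    v ∈ ridge κ (Ideal.span {homogeneousComponent (centreOrder A f) f}) := by
  refine mem_ridge_span_singleton_of_shift_map_eq (shift_map_eq_of_dehomog_mem_pow
    (homogeneousComponent_isHomogeneous _ _) (fibreRestrict_dehomog_homogeneousComponent K A hj f)
    π hπj hπA ?_ v hvj hv)
  obtain ⟨s, hs, hsf⟩ := hnear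
  have hQj : (X j : MvPolynomial (Fin m) K) ∈ RingHom.ker π := hπj
  have hQ : ∀ i ∉ A, (X i : MvPolynomial (Fin m) K) ∈ RingHom.ker π := hπA
  obtain ⟨hs', h'⟩ := fibreRestrict_mul_mem_pow K A j hQj hQ (s := s) hs hsf
  rw [fibreRestrict_coordProperTransform K A hj] at h'
  exact ⟨_, hs', h'⟩

/-- **The structure theorem for the initial form at a near point** (same hypotheses): over `κ`,
`in_0 f ⊗ κ = G(X_i − π(X_i)·X_j : i ∈ A ∖ j)` for a form `G` of degree `l` in the variables `X_i`, `i ∈ A ∖ j`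
— the near point lies in the projectivised DIRECTRIX of the base-changed tangent cone `C_0 ⊗_K κ` modulo `T_0 D`.
[folklore] -/
theorem exists_form_eq_aeval_of_near (A : Set σ) {j : σ} (hj : j ∈ A) (f : MvPolynomial σ K)
    (π : MvPolynomial σ K →ₐ[K] κ) (hπj : π (X j) = 0) (hπA : ∀ i ∉ A, π (X i) = 0)
    (hnear : ∃ s, π s ≠ 0 ∧ s * coordProperTransform K A j f ∈ RingHom.ker π ^ centreOrder A f) :
    ∃ G : MvPolynomial σ κ, G.IsHomogeneous (centreOrder A f) ∧ fibreRestrict κ A j G = G ∧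
      map (algebraMap K κ) (homogeneousComponent (centreOrder A f) f) =
        aeval (fun i => X i - C (π (X i)) * X j) G := by
  refine exists_form_eq_aeval_of_dehomog_mem_pow (homogeneousComponent_isHomogeneous _ _)
    (fibreRestrict_dehomog_homogeneousComponent K A hj f) π hπj hπA ?_
  obtain ⟨s, hs, hsf⟩ := hnear
  have hQj : (X j : MvPolynomial σ K) ∈ RingHom.ker π := hπj
  have hQ : ∀ i ∉ A, (X i : MvPolynomial σ K) ∈ RingHom.ker π := hπA
  obtain ⟨hs', h'⟩ := fibreRestrict_mul_mem_pow K A j hQj hQ (s := s) hs hsf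
  rw [fibreRestrict_coordProperTransform K A hj] at h'
  exact ⟨_, hs', h'⟩

/-- **Translation invariance of the initial form at a near point** (same hypotheses), for general index types.
[folklore] -/
theorem shift_map_eq_of_near (A : Set σ) {j : σ} (hj : j ∈ A) (f : MvPolynomial σ K)
    (π : MvPolynomial σ K →ₐ[K] κ) (hπj : π (X j) = 0) (hπA : ∀ i ∉ A, π (X i) = 0)
    (hnear : ∃ s, π s ≠ 0 ∧ s * coordProperTransform K A j f ∈ RingHom.ker π ^ centreOrder A f)
    (v : σ → κ) (hvj : v j = 1) (hv : ∀ i ∈ A, i ≠ j → v i = π (X i)) :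
    shift v (map (algebraMap K κ) (homogeneousComponent (centreOrder A f) f)) =
      map (algebraMap K κ) (homogeneousComponent (centreOrder A f) f) := by
  obtain ⟨G, -, hGfix, hFG⟩ := exists_form_eq_aeval_of_near A hj f π hπj hπA hnear
  rw [hFG, ← AlgHom.comp_apply, comp_aeval]
  refine aeval_congr_of_fibreRestrict_eq κ A j hGfix fun i hiA hij => ?_
  simp only [map_sub, map_mul, shift_X, algHom_C, MvPolynomial.algebraMap_eq, hv i hiA hij, hvj, map_one]
  ring

/-! ### The tangent space of the centre lies in the ridge -/
omit [DecidableEq σ] in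
/-- **`T_0(D) ⊆ F(C_0)`**: translation by a vector tangent to the centre (`w_i = 0` for `i ∈ A`) fixes the degree-`l`
component `F` of `f`, `l = centreOrder A f`, which involves centre variables only. [folklore] -/
theorem shift_map_eq_of_forall_eq_zero (A : Set σ) (f : MvPolynomial σ K) (w : σ → κ) (hw : ∀ i ∈ A, w i = 0) :
    shift w (map (algebraMap K κ) (homogeneousComponent (centreOrder A f) f)) =
      map (algebraMap K κ) (homogeneousComponent (centreOrder A f) f) := by
  classical
  rw [homogeneousComponent_apply, map_sum, map_sum]
  refine Finset.sum_congr rfl fun d hd => ?_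
  rw [Finset.mem_filter] at hd
  obtain ⟨hd, hdeg⟩ := hd
  have hc : centreDegree A d = d.degree :=
    le_antisymm (centreDegree_le_degree A d) (hdeg ▸ centreOrder_le K A hd)
  rw [map_monomial, show shift w (monomial d (algebraMap K κ (coeff d f))) =
      aeval (fun i => X i + C (w i)) (monomial d (algebraMap K κ (coeff d f))) from rfl,
    aeval_monomial, monomial_eq, MvPolynomial.algebraMap_eq]
  congr 1
  refine Finsupp.prod_congr fun i hi => ?_
  have hiA : i ∈ A := by
    by_contra hiA
    exact (Finsupp.mem_support_iff.mp hi) (apply_eq_zero_of_centreDegree_eq_degree A hc hiA)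
  rw [hw i hiA, C_0, add_zero]

/-- **`T_0(D)(κ) ⊆ F(C_0)(κ)`** for the principal cone of the degree-`l` component: the quotient `F(C_0)/T_0(D)` of
the informal crux makes sense. [folklore] -/
theorem mem_ridge_of_forall_eq_zero (A : Set (Fin m)) (f : MvPolynomial (Fin m) K) (w : Fin m → κ)
    (hw : ∀ i ∈ A, w i = 0) :
    w ∈ ridge κ (Ideal.span {homogeneousComponent (centreOrder A f) f}) :=
  mem_ridge_span_singleton_of_shift_map_eq (shift_map_eq_of_forall_eq_zero A f w hw)

/-! ### Scheme points of the exceptional fibre: residue fields -/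
/-- **RIDGE CONFINEMENT AT EVERY SCHEME POINT OF THE EXCEPTIONAL FIBRE** (closed or not): for a prime ideal `𝔴` of
the chart ring containing `X_j` and the `X_i`, `i ∉ A` (a point of `π⁻¹(0)`), at which the proper transform has
order `≥ l` (`∃ s ∉ 𝔴, s · f_𝔙 ∈ 𝔴^l`, i.e. `f_𝔙 ∈ 𝔴^l K[X]_𝔴` — NEAR), the tautological direction
`(X̄_i)_{i ∈ A ∖ j}, 1` with values in the residue field `κ(𝔴)` is a `κ(𝔴)`-point of Giraud's ridge of the cone of
the degree-`l` component: `x' ∈ ℙ(F_0(X)/T_0 D)`. [OURS · L1 W4.2, hypersurface instance of `RidgeConfinement`;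
NOT a statement of the manuscript.] [folklore] -/
theorem residue_mem_ridge_of_near (A : Set (Fin m)) {j : Fin m} (hj : j ∈ A) (f : MvPolynomial (Fin m) K)
    (Q : Ideal (MvPolynomial (Fin m) K)) [Q.IsPrime] (hQj : (X j : MvPolynomial (Fin m) K) ∈ Q)
    (hQ : ∀ i ∉ A, (X i : MvPolynomial (Fin m) K) ∈ Q)
    (hnear : ∃ s ∉ Q, s * coordProperTransform K A j f ∈ Q ^ centreOrder A f) :
    (fun i => if i = j then (1 : Q.ResidueField) else algebraMap (MvPolynomial (Fin m) K) Q.ResidueField (X i)) ∈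
      ridge Q.ResidueField (Ideal.span {homogeneousComponent (centreOrder A f) f}) := by
  set π : MvPolynomial (Fin m) K →ₐ[K] Q.ResidueField :=
    IsScalarTower.toAlgHom K (MvPolynomial (Fin m) K) Q.ResidueField with hπ
  have hπapp : ∀ p, π p = algebraMap (MvPolynomial (Fin m) K) Q.ResidueField p := fun p => rfl
  have hker : RingHom.ker π = Q := by
    ext p
    rw [RingHom.mem_ker, hπapp, Ideal.algebraMap_residueField_eq_zero]
  refine mem_ridge_of_near A hj f π ?_ ?_ ?_ _ (if_pos rfl) ?_
  · rw [hπapp, Ideal.algebraMap_residueField_eq_zero]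
    exact hQj
  · intro i hi
    rw [hπapp, Ideal.algebraMap_residueField_eq_zero]
    exact hQ i hi
  · obtain ⟨s, hs, h⟩ := hnear
    refine ⟨s, ?_, by rwa [hker]⟩
    rw [Ne, hπapp, Ideal.algebraMap_residueField_eq_zero]
    exact hs
  · intro i _ hij
    rw [if_neg hij, hπapp]

end Main

end CampaignW42

end Summit.ResolutionOfSingularities.ResolutionOfSingularities.Theorems

end
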